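import Literature.Computability.Complexity.RandomizingPolynomialsPerfect
import HarnessLib

/-!
# Randomizing polynomials V: the degree-3 encoding of a sparse polynomial map (objects)

The composition level of the degree reduction [Dvir–Gutfreund–Rothblum–Vadhan 2010, Thm 4.5 /
Claim 4.4]: a polynomial `p = T₁ + ⋯ + T_t` (nonempty monomials) is split with fresh MASKS
`r₁, …, r_{t-1}` into the pieces `T_j + r_{j-1} + r_j`, and each piece is replaced by its degree-3
block (file III); a map is encoded coordinate by coordinate with consecutive fresh blocks.

* `VarsIn S O` (all variables of `O` satisfy `S`) and the congruence lemmas it feeds;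
* `encodePolyAux`, `encodePoly`, `encodeMap`; counters (`le_…_fst`), supports (`varsIn_…`), degree
  (`length_le_three_…`: every monomial of the encoding has length `≤ 3`);
* the CLOSED FORMS of the counters (`sizeOf`, `prefixSize`, `usedVars`, `startOf`, `masksOf`,
  `blocksOf`, `prefixUsed`; `encodePolyAux_eq`, `encodePoly_eq`, `encodeMap_eq`), the shape in
  which the polynomial-time program of files VII–VIII computes the encoding with `map`s.

Not here: the perfect-extension theorems (file V-b `DegreeThreeEncodingPerfect.lean`), entropy
(file VI), polynomial time (files VII–VIII).

## References

* Z. Dvir, D. Gutfreund, G. N. Rothblum, S. Vadhan, ECCC TR10-160 (2010), Thm 4.5, Claim 4.4.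
* B. Applebaum, Y. Ishai, E. Kushilevitz, SIAM J. Comput. 36 (2006), §4.
-/

namespace Literature.Computability.Complexity

namespace RandPoly

/-! ### Variables of a block -/

/-- All variables occurring in the polynomial map `O` satisfy `S`. [folklore] -/
def VarsIn (S : ℕ → Prop) (O : List (List (List ℕ))) : Prop := ∀ q ∈ O, ∀ μ ∈ q, ∀ x ∈ μ, S x

variable {v w : ℕ → ZMod 2}

/-- `VarsIn` is monotone in the predicate. [folklore] -/
theorem VarsIn.mono {S S' : ℕ → Prop} (h : ∀ x, S x → S' x) {O : List (List (List ℕ))}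
    (hO : VarsIn S O) : VarsIn S' O := fun q hq μ hμ x hx => h x (hO q hq μ hμ x hx)

/-- `VarsIn` of a concatenation. [folklore] -/
theorem varsIn_append {S : ℕ → Prop} {O₁ O₂ : List (List (List ℕ))} :
    VarsIn S (O₁ ++ O₂) ↔ VarsIn S O₁ ∧ VarsIn S O₂ := by
  simp only [VarsIn, List.mem_append]
  exact ⟨fun h => ⟨fun q hq => h q (Or.inl hq), fun q hq => h q (Or.inr hq)⟩,
    fun h q hq => hq.elim (h.1 q) (h.2 q)⟩

/-- The empty map has no variables. [folklore] -/
theorem varsIn_nil (S : ℕ → Prop) : VarsIn S [] := fun _ h => absurd h List.not_mem_nil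

/-- Values agree when the valuations agree on the variables. [folklore] -/
theorem evalM_congr_of_varsIn {S : ℕ → Prop} {O : List (List (List ℕ))} (hO : VarsIn S O)
    (h : ∀ x, S x → v x = w x) : evalM v O = evalM w O :=
  evalM_congr fun q hq μ hμ x hx => h x (hO q hq μ hμ x hx)

/-- The value of a polynomial with variables below `n` depends only on the prefix. [folklore] -/
theorem evalP_congr_below {n : ℕ} {p : List (List ℕ)} (hp : ∀ μ ∈ p, ∀ x ∈ μ, x < n)
    (h : AgreeBelow n v w) : evalP v p = evalP w p :=
  evalP_congr fun μ hμ x hx => h x (hp μ hμ x hx)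

/-! ### The encoding of a polynomial and of a map -/

/-- Number of fresh variables of the block of the monomial `T`. [cite: IshaiKushilevitz2002, §3] -/
def blockSize (T : List ℕ) : ℕ := pos (T.length - 1) (T.length - 1)

/-- **Encoding of a polynomial with an incoming mask list** (all monomials nonempty): the last
monomial is encoded with the incoming masks; otherwise a fresh mask `n` is shared between the block
of the first monomial (variables from `n + 1`) and the encoding of the rest.  Returns the new
counter and the output polynomials. [cite: DvirGutfreundRothblumVadhan2010, Thm 4.5] -/
def encodePolyAux : ℕ → List ℕ → List (List ℕ) → ℕ × List (List (List ℕ))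
  | n, _, [] => (n, [])
  | n, ρ, [T] => (n + blockSize T, ikBlock n T ρ)
  | n, ρ, T :: T' :: rest =>
      ((encodePolyAux (n + 1 + blockSize T) [n] (T' :: rest)).1,
        ikBlock (n + 1) T (ρ ++ [n]) ++ (encodePolyAux (n + 1 + blockSize T) [n] (T' :: rest)).2)

/-- **Encoding of a polynomial**: drop the empty monomials (a constant shift of the value), then
encode with no incoming mask. [cite: DvirGutfreundRothblumVadhan2010, Thm 4.5] -/
def encodePoly (n : ℕ) (p : List (List ℕ)) : ℕ × List (List (List ℕ)) :=
  encodePolyAux n [] (p.filter (· ≠ []))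

/-- **Encoding of a polynomial map**, coordinate by coordinate with consecutive fresh blocks.
[cite: DvirGutfreundRothblumVadhan2010, Thm 4.5] -/
def encodeMap : ℕ → List (List (List ℕ)) → ℕ × List (List (List ℕ))
  | n, [] => (n, [])
  | n, p :: P => ((encodeMap (encodePoly n p).1 P).1, (encodePoly n p).2 ++ (encodeMap (encodePoly n p).1 P).2)

/-! ### Counters and supports -/

/-- The counter of `encodePolyAux` does not decrease. [folklore] -/
theorem le_encodePolyAux_fst (n : ℕ) (ρ : List ℕ) (p : List (List ℕ)) : n ≤ (encodePolyAux n ρ p).1 := by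
  induction p generalizing n ρ with
  | nil => exact le_rfl
  | cons T rest ih =>
    cases rest with
    | nil => exact Nat.le_add_right _ _
    | cons T' rest => exact le_trans (by omega) (ih (n + 1 + blockSize T) [n])

/-- The counter of `encodePoly` does not decrease. [folklore] -/
theorem le_encodePoly_fst (n : ℕ) (p : List (List ℕ)) : n ≤ (encodePoly n p).1 :=
  le_encodePolyAux_fst _ _ _

/-- The counter of `encodeMap` does not decrease. [folklore] -/
theorem le_encodeMap_fst (n : ℕ) (P : List (List (List ℕ))) : n ≤ (encodeMap n P).1 := by
  induction P generalizing n with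
  | nil => exact le_rfl
  | cons p P ih => exact (le_encodePoly_fst n p).trans (ih _)

/-- **Support of `encodePolyAux`**: variables of the monomials, incoming masks, or fresh variables
in `[n, counter)`. [folklore] -/
theorem varsIn_encodePolyAux (n : ℕ) (ρ : List ℕ) (p : List (List ℕ)) (hp : ∀ T ∈ p, T ≠ []) :
    VarsIn (fun x => (∃ T ∈ p, x ∈ T) ∨ x ∈ ρ ∨ (n ≤ x ∧ x < (encodePolyAux n ρ p).1))
      (encodePolyAux n ρ p).2 := by
  induction p generalizing n ρ with
  | nil => exact varsIn_nil _
  | cons T rest ih =>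
    cases rest with
    | nil =>
      intro q hq μ hμ x hx
      rcases (mem_ikBlock (hp T (by simp)) hq hμ).2 x hx with h | h | h
      · exact Or.inl ⟨T, by simp, h⟩
      · exact Or.inr (Or.inl h)
      · exact Or.inr (Or.inr h)
    | cons T' rest =>
      have hle := le_encodePolyAux_fst (n + 1 + blockSize T) [n] (T' :: rest)
      have e1 : (encodePolyAux n ρ (T :: T' :: rest)).1 =
          (encodePolyAux (n + 1 + blockSize T) [n] (T' :: rest)).1 := rfl
      have e2 : (encodePolyAux n ρ (T :: T' :: rest)).2 =
          ikBlock (n + 1) T (ρ ++ [n]) ++ (encodePolyAux (n + 1 + blockSize T) [n] (T' :: rest)).2 := rfl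
      have hbs : blockSize T = pos (T.length - 1) (T.length - 1) := rfl
      rw [e1, e2]
      refine varsIn_append.2 ⟨fun q hq μ hμ x hx => ?_, ?_⟩
      · rcases (mem_ikBlock (hp T (by simp)) hq hμ).2 x hx with h | h | h
        · exact Or.inl ⟨T, by simp, h⟩
        · rw [List.mem_append, List.mem_singleton] at h
          rcases h with h | h
          · exact Or.inr (Or.inl h)
          · exact Or.inr (Or.inr ⟨le_of_eq h.symm, by omega⟩)
        · exact Or.inr (Or.inr ⟨by omega, by omega⟩)
      · refine (ih (n + 1 + blockSize T) [n] fun T'' hT'' => hp T'' (List.mem_cons_of_mem _ hT'')).mono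
          fun x hx => ?_
        rcases hx with ⟨T'', hT'', hxT⟩ | hx | hx
        · exact Or.inl ⟨T'', List.mem_cons_of_mem _ hT'', hxT⟩
        · rw [List.mem_singleton] at hx
          exact Or.inr (Or.inr ⟨le_of_eq hx.symm, by omega⟩)
        · exact Or.inr (Or.inr ⟨by omega, hx.2⟩)

/-- **Support of `encodePoly`**: variables of `p` or fresh variables in `[n, counter)`. [folklore] -/
theorem varsIn_encodePoly (n : ℕ) (p : List (List ℕ)) :
    VarsIn (fun x => (∃ T ∈ p, x ∈ T) ∨ (n ≤ x ∧ x < (encodePoly n p).1)) (encodePoly n p).2 := by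
  refine (varsIn_encodePolyAux n [] (p.filter (· ≠ [])) fun T hT => ?_).mono fun x hx => ?_
  · exact of_decide_eq_true (List.mem_filter.1 hT).2
  · rcases hx with ⟨T, hT, hxT⟩ | hx | hx
    · exact Or.inl ⟨T, (List.mem_filter.1 hT).1, hxT⟩
    · exact absurd hx List.not_mem_nil
    · exact Or.inr hx

/-- **Support of `encodeMap`**: variables of `P` or fresh variables in `[n, counter)`. [folklore] -/
theorem varsIn_encodeMap (n : ℕ) (P : List (List (List ℕ))) :
    VarsIn (fun x => (∃ p ∈ P, ∃ T ∈ p, x ∈ T) ∨ (n ≤ x ∧ x < (encodeMap n P).1)) (encodeMap n P).2 := by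
  induction P generalizing n with
  | nil => exact varsIn_nil _
  | cons p P ih =>
    have hle₁ := le_encodePoly_fst n p
    have hle₂ := le_encodeMap_fst (encodePoly n p).1 P
    refine varsIn_append.2 ⟨(varsIn_encodePoly n p).mono fun x hx => ?_, (ih _).mono fun x hx => ?_⟩
    · rcases hx with ⟨T, hT, hxT⟩ | hx
      · exact Or.inl ⟨p, by simp, T, hT, hxT⟩
      · exact Or.inr ⟨hx.1, lt_of_lt_of_le hx.2 hle₂⟩
    · rcases hx with ⟨p', hp', T, hT, hxT⟩ | hx
      · exact Or.inl ⟨p', List.mem_cons_of_mem _ hp', T, hT, hxT⟩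
      · exact Or.inr ⟨hle₁.trans hx.1, hx.2⟩

/-- **Degree of the encoding**: every monomial of `encodePolyAux` has length `≤ 3`. [folklore] -/
theorem length_le_three_encodePolyAux (n : ℕ) (ρ : List ℕ) (p : List (List ℕ)) (hp : ∀ T ∈ p, T ≠ [])
    {q : List (List ℕ)} (hq : q ∈ (encodePolyAux n ρ p).2) {μ : List ℕ} (hμ : μ ∈ q) : μ.length ≤ 3 := by
  induction p generalizing n ρ with
  | nil => exact absurd hq List.not_mem_nil
  | cons T rest ih =>
    cases rest with
    | nil => exact (mem_ikBlock (hp T (by simp)) hq hμ).1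
    | cons T' rest =>
      change q ∈ ikBlock (n + 1) T (ρ ++ [n]) ++ _ at hq
      rcases List.mem_append.1 hq with hq | hq
      · exact (mem_ikBlock (hp T (by simp)) hq hμ).1
      · exact ih _ _ (fun T'' hT'' => hp T'' (List.mem_cons_of_mem _ hT'')) hq

/-- **Degree of the encoding of a map**: every monomial has length `≤ 3`. [folklore] -/
theorem length_le_three_encodeMap (n : ℕ) (P : List (List (List ℕ))) {q : List (List ℕ)}
    (hq : q ∈ (encodeMap n P).2) {μ : List ℕ} (hμ : μ ∈ q) : μ.length ≤ 3 := by
  induction P generalizing n with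
  | nil => exact absurd hq List.not_mem_nil
  | cons p P ih =>
    change q ∈ (encodePoly n p).2 ++ _ at hq
    rcases List.mem_append.1 hq with hq | hq
    · exact length_le_three_encodePolyAux n [] _
        (fun T hT => of_decide_eq_true (List.mem_filter.1 hT).2) hq hμ
    · exact ih _ hq

/-! ### Closed forms -/

/-- Fresh variables consumed by the piece of a monomial: its block and one mask. [folklore] -/
def sizeOf (T : List ℕ) : ℕ := blockSize T + 1

/-- Prefix sums of the piece sizes of a polynomial. [folklore] -/
def prefixSize (p : List (List ℕ)) (j : ℕ) : ℕ := ((p.take j).map sizeOf).sum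

/-- Fresh variables consumed by a polynomial with nonempty monomials (`0` for the zero polynomial).
[folklore] -/
def usedVars (p : List (List ℕ)) : ℕ := prefixSize p p.length - 1

/-- Counter at which the block of monomial `j` starts. [folklore] -/
def startOf (n : ℕ) (p : List (List ℕ)) (j : ℕ) : ℕ :=
  n + prefixSize p j + (if j + 1 < p.length then 1 else 0)

/-- Masks of monomial `j`: the incoming one (the previous mask, or `ρ` for `j = 0`) and, unless `j`
is last, its own. [folklore] -/
def masksOf (n : ℕ) (ρ : List ℕ) (p : List (List ℕ)) (j : ℕ) : List ℕ :=
  (if j = 0 then ρ else [n + prefixSize p (j - 1)]) ++ (if j + 1 < p.length then [n + prefixSize p j] else [])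

/-- The blocks of a polynomial, monomial by monomial. [folklore] -/
def blocksOf (n : ℕ) (ρ : List ℕ) (p : List (List ℕ)) : List (List (List ℕ)) :=
  (List.range p.length).flatMap fun j => ikBlock (startOf n p j) (p.getD j []) (masksOf n ρ p j)

/-- Fresh variables consumed by the polynomials before index `i` of a map. [folklore] -/
def prefixUsed (P : List (List (List ℕ))) (i : ℕ) : ℕ :=
  ((P.take i).map fun p => usedVars (p.filter (· ≠ []))).sum

/-- `prefixSize` at `0`. [folklore] -/
@[simp] theorem prefixSize_zero (p : List (List ℕ)) : prefixSize p 0 = 0 := by simp [prefixSize]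

/-- `prefixSize` of a cons, one step. [folklore] -/
theorem prefixSize_cons_succ (T : List ℕ) (q : List (List ℕ)) (j : ℕ) :
    prefixSize (T :: q) (j + 1) = sizeOf T + prefixSize q j := by
  simp [prefixSize]

/-- Full prefix of a nonempty-sized list is positive. [folklore] -/
theorem prefixSize_length_pos {p : List (List ℕ)} (hp : p ≠ []) : 0 < prefixSize p p.length := by
  cases p with
  | nil => exact absurd rfl hp
  | cons T q => rw [List.length_cons, prefixSize_cons_succ]; unfold sizeOf; omega

/-- `usedVars` of a cons with a nonempty tail. [folklore] -/
theorem usedVars_cons {T : List ℕ} {q : List (List ℕ)} (hq : q ≠ []) :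
    usedVars (T :: q) = blockSize T + 1 + usedVars q := by
  unfold usedVars
  rw [List.length_cons, prefixSize_cons_succ]
  have := prefixSize_length_pos hq
  unfold sizeOf; omega

/-- Splitting the first index off a `flatMap` over a range. [folklore] -/
theorem flatMap_range_succ {α : Type} (g : ℕ → List α) (k : ℕ) :
    (List.range (k + 1)).flatMap g = g 0 ++ (List.range k).flatMap fun j => g (j + 1) := by
  rw [List.range_succ_eq_map, List.flatMap_cons, List.flatMap_map]

/-- The block of the first monomial of a polynomial with at least two monomials starts at `n + 1`.
[folklore] -/
theorem startOf_cons_zero {T : List ℕ} {q : List (List ℕ)} (hq : q ≠ []) (n : ℕ) :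
    startOf n (T :: q) 0 = n + 1 := by
  have := List.length_pos_of_ne_nil hq
  simp [startOf]; omega

/-- Its masks are the incoming ones and the fresh mask `n`. [folklore] -/
theorem masksOf_cons_zero {T : List ℕ} {q : List (List ℕ)} (hq : q ≠ []) (n : ℕ) (ρ : List ℕ) :
    masksOf n ρ (T :: q) 0 = ρ ++ [n] := by
  have := List.length_pos_of_ne_nil hq
  simp [masksOf]; omega

/-- Later blocks are the blocks of the tail started at `n + sizeOf T`. [folklore] -/
theorem startOf_cons_succ (T : List ℕ) (q : List (List ℕ)) (n j : ℕ) :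
    startOf n (T :: q) (j + 1) = startOf (n + sizeOf T) q j := by
  simp only [startOf, prefixSize_cons_succ, List.length_cons]
  split_ifs <;> omega

/-- Later masks are the masks of the tail with incoming mask `n`. [folklore] -/
theorem masksOf_cons_succ (T : List ℕ) (q : List (List ℕ)) (n j : ℕ) (ρ : List ℕ) :
    masksOf n ρ (T :: q) (j + 1) = masksOf (n + sizeOf T) [n] q j := by
  simp only [masksOf, prefixSize_cons_succ, List.length_cons, Nat.add_sub_cancel, Nat.succ_ne_zero,
    if_false]
  congr 1
  · cases j with
    | zero => simp
    | succ j' => rw [if_neg (Nat.succ_ne_zero _), Nat.add_sub_cancel, prefixSize_cons_succ]; simp only [Nat.add_assoc]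
  · by_cases h : j + 1 < q.length
    · rw [if_pos (by omega), if_pos h]; simp only [Nat.add_assoc]
    · rw [if_neg (by omega), if_neg h]

/-- **Blocks of a cons**: the first block with a fresh mask, then the blocks of the tail. [folklore] -/
theorem blocksOf_cons {T : List ℕ} {q : List (List ℕ)} (hq : q ≠ []) (n : ℕ) (ρ : List ℕ) :
    blocksOf n ρ (T :: q) = ikBlock (n + 1) T (ρ ++ [n]) ++ blocksOf (n + sizeOf T) [n] q := by
  unfold blocksOf
  rw [List.length_cons, flatMap_range_succ, startOf_cons_zero hq, masksOf_cons_zero hq]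
  congr 1
  exact List.flatMap_congr fun j _ => by
    rw [startOf_cons_succ, masksOf_cons_succ, List.getD_cons_succ]

/-- **Closed form of `encodePolyAux`**: counter `n + usedVars p`, outputs `blocksOf n ρ p`.
[folklore] -/
theorem encodePolyAux_eq (n : ℕ) (ρ : List ℕ) (p : List (List ℕ)) :
    encodePolyAux n ρ p = (n + usedVars p, blocksOf n ρ p) := by
  induction p generalizing n ρ with
  | nil => simp [encodePolyAux, usedVars, blocksOf]
  | cons T q ih =>
    cases q with
    | nil =>
      simp [encodePolyAux, usedVars, blocksOf, prefixSize, sizeOf, startOf, masksOf]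
    | cons T' rest =>
      have hq : (T' :: rest) ≠ [] := List.cons_ne_nil _ _
      have hs : n + 1 + blockSize T = n + sizeOf T := by unfold sizeOf; omega
      rw [show encodePolyAux n ρ (T :: T' :: rest) =
        ((encodePolyAux (n + 1 + blockSize T) [n] (T' :: rest)).1,
          ikBlock (n + 1) T (ρ ++ [n]) ++ (encodePolyAux (n + 1 + blockSize T) [n] (T' :: rest)).2) from rfl,
        ih, usedVars_cons hq, blocksOf_cons hq, hs]
      refine Prod.ext ?_ rfl
      show n + sizeOf T + usedVars (T' :: rest) = n + (blockSize T + 1 + usedVars (T' :: rest))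
      unfold sizeOf; omega

/-- **Closed form of `encodePoly`.** [folklore] -/
theorem encodePoly_eq (n : ℕ) (p : List (List ℕ)) :
    encodePoly n p = (n + usedVars (p.filter (· ≠ [])), blocksOf n [] (p.filter (· ≠ []))) :=
  encodePolyAux_eq _ _ _

/-- `prefixUsed` at `0`. [folklore] -/
@[simp] theorem prefixUsed_zero (P : List (List (List ℕ))) : prefixUsed P 0 = 0 := by simp [prefixUsed]

/-- `prefixUsed` of a cons, one step. [folklore] -/
theorem prefixUsed_cons_succ (p : List (List ℕ)) (Q : List (List (List ℕ))) (i : ℕ) :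
    prefixUsed (p :: Q) (i + 1) = usedVars (p.filter (· ≠ [])) + prefixUsed Q i := by
  simp only [prefixUsed, List.take_succ_cons, List.map_cons, List.sum_cons]

/-- **Closed form of `encodeMap`.** [folklore] -/
theorem encodeMap_eq (n : ℕ) (P : List (List (List ℕ))) :
    encodeMap n P = (n + prefixUsed P P.length,
      (List.range P.length).flatMap fun i => blocksOf (n + prefixUsed P i) [] ((P.getD i []).filter (· ≠ []))) := by
  induction P generalizing n with
  | nil => simp [encodeMap, prefixUsed]
  | cons p Q ih =>
    rw [show encodeMap n (p :: Q) = ((encodeMap (encodePoly n p).1 Q).1,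
      (encodePoly n p).2 ++ (encodeMap (encodePoly n p).1 Q).2) from rfl, encodePoly_eq, ih]
    refine Prod.ext ?_ ?_
    · show n + usedVars _ + prefixUsed Q Q.length = n + prefixUsed (p :: Q) (Q.length + 1)
      rw [prefixUsed_cons_succ, Nat.add_assoc]
    · show blocksOf n [] _ ++ _ = _
      rw [List.length_cons, flatMap_range_succ, prefixUsed_zero, Nat.add_zero, List.getD_cons_zero]
      congr 1
      exact List.flatMap_congr fun i _ => by rw [List.getD_cons_succ, prefixUsed_cons_succ, Nat.add_assoc]

end RandPoly

end Literature.Computability.Complexity
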